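import Mathlib
import Summits.MatrixMultiplication.MatrixMultiplication.Theses.GLnSeparatingDesigns

/-!
# The GL_n separation-degree law refutes `BorderHalfDimensionDesigns`

Stub `stub_not_borderHalfDimensionDesigns_of_law` of line `Ideate5Sketch` (crux
`BorderHalfDimensionDesigns`, item stmt-MatrixMultiplication-18360, route `GLnSeparatingDesigns`).

Given the (conjectural) uniform GL_n separation-degree law `hlaw` — every finite `X, Y, Z ⊆ GL_n(ℂ)`,
`n ≥ 3`, with `η`-approximate separators of total degree `≤ s` for every target and `η·|X||Y||Z| < 1`
has `|X||Y||Z| ≤ C(n) (s+1)^(n(n−1)/2) C(2s+n², n²)` — the crux fails: take `ε := 1/8`, the `n` it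
yields, `δ := 1/(16 n)` and `q ≥ exp (K + 1)` with `K := 8 (|log C| + n²/2 + 2 n² log n)`; shrink the
designs to exactly `N := ⌈q^(n²/2 − n/8)⌉` elements each, put `s := ⌊q^(1+δ)⌋`, `η := 1/(2(N³+1))`;
the law then reads, after logarithms and `C(2s+n²,n²) ≤ (2s+n²)^(n²) ≤ (s n²)^(n²)`,
`((n+1)/32) log q ≤ log C + n²/2 + 2 n² log n`, contradicting the choice of `q`.
Pure real-analysis bookkeeping (same style as the deciding theorem `closes`).
-/

set_option linter.dupNamespace false

open Summit.MatrixMultiplication.MatrixMultiplication.Theses.GLnSeparatingDesigns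

namespace Summit.MatrixMultiplication.MatrixMultiplication.Theorems.BorderHalfDimensionDesigns

/-- **Transfer (numerics).** The uniform GL_n separation-degree law C⁻ (`hlaw`, `n ≥ 3`:
`|X||Y||Z| ≤ C(n) (s+1)^(n(n−1)/2) C(2s+n², n²)` for designs with `η`-separators of degree `≤ s` and
`η |X||Y||Z| < 1`) refutes the crux `BorderHalfDimensionDesigns`: with `ε = 1/8`, `δ = 1/(16 n)`,
designs shrunk to `N = ⌈q^(n²/2 − n/8)⌉` elements each, `s = ⌊q^(1+δ)⌋` and `η = 1/(2(N³+1))` the law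
gives `((n+1)/32) log q ≤ log C + n²/2 + 2 n² log n`, false for `q ≥ exp (8(|log C| + n²/2 + 2n² log n) + 1)`. -/
theorem stub_not_borderHalfDimensionDesigns_of_law
    (hlaw : ∀ n : ℕ, 3 ≤ n → ∃ C : ℝ, 0 < C ∧ ∀ s : ℕ, 2 ≤ s →
      ∀ (X Y Z : Finset (Matrix.GeneralLinearGroup (Fin n) ℂ)) (η : ℝ),
        η * ((X.card : ℝ) * Y.card * Z.card) < 1 →
        (∀ x₀ ∈ X, ∀ z₀ ∈ Z, ∃ p : MvPolynomial (Fin n × Fin n) ℂ, p.totalDegree ≤ s ∧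
          ∀ x ∈ X, ∀ y ∈ Y, ∀ y' ∈ Y, ∀ z ∈ Z,
            ((x = x₀ ∧ y = y' ∧ z = z₀) → ‖MvPolynomial.eval (fun ij : Fin n × Fin n =>
              ((x * y⁻¹ * y' * z⁻¹ : Matrix.GeneralLinearGroup (Fin n) ℂ) : Matrix (Fin n) (Fin n) ℂ) ij.1 ij.2) p - 1‖ ≤ η) ∧
            (¬ (x = x₀ ∧ y = y' ∧ z = z₀) → ‖MvPolynomial.eval (fun ij : Fin n × Fin n =>
              ((x * y⁻¹ * y' * z⁻¹ : Matrix.GeneralLinearGroup (Fin n) ℂ) : Matrix (Fin n) (Fin n) ℂ) ij.1 ij.2) p‖ ≤ η)) →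
        (X.card : ℝ) * Y.card * Z.card ≤
          C * ((s : ℝ) + 1) ^ (n * (n - 1) / 2) * ((2 * s + n ^ 2).choose (n ^ 2) : ℝ)) :
    ¬ BorderHalfDimensionDesigns := by
  intro hcrux
  -- ε := 1/8 gives n ≥ 3; the law gives C = C(n) > 0
  obtain ⟨n, hn3, hn⟩ := hcrux (1 / 8) (by norm_num)
  obtain ⟨C, hCpos, hL⟩ := hlaw n hn3
  have hnpos : (0 : ℝ) < n := by exact_mod_cast (by omega : 0 < n)
  have hn0 : (n : ℝ) ≠ 0 := hnpos.ne'
  have hn3r : (3 : ℝ) ≤ n := by exact_mod_cast hn3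
  have hln : 0 ≤ Real.log n := Real.log_nonneg (by linarith)
  -- δ := 1/(16 n), K := 8 (|log C| + n²/2 + 2 n² log n), q₀ := ⌈exp (K+1)⌉₊
  obtain ⟨δ, hδdef⟩ : ∃ δ : ℝ, δ = 1 / (16 * n) := ⟨_, rfl⟩
  have hδpos : 0 < δ := by rw [hδdef]; positivity
  obtain ⟨K, hKdef⟩ : ∃ K : ℝ,
      K = 8 * (|Real.log C| + (n : ℝ) ^ 2 / 2 + 2 * (n : ℝ) ^ 2 * Real.log n) := ⟨_, rfl⟩
  have hKnn : 0 ≤ K := by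
    have h1 : 0 ≤ |Real.log C| := abs_nonneg _
    have h2 : 0 ≤ (n : ℝ) ^ 2 * Real.log n := mul_nonneg (by positivity) hln
    have h3 : 0 ≤ (n : ℝ) ^ 2 := by positivity
    rw [hKdef]; linarith only [h1, h2, h3]
  obtain ⟨q, hq₀, hq⟩ := hn δ hδpos ⌈Real.exp (K + 1)⌉₊
  have hqK : Real.exp (K + 1) ≤ q := le_trans (Nat.le_ceil _) (by exact_mod_cast hq₀)
  have hq2 : (2 : ℝ) ≤ q := by
    have := Real.add_one_le_exp (K + 1)
    linarith
  have hqpos : (0 : ℝ) < q := by linarith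
  have hq1 : (1 : ℝ) ≤ q := by linarith
  obtain ⟨L, hLdef⟩ : ∃ L : ℝ, L = Real.log q := ⟨_, rfl⟩
  have hLK : K + 1 ≤ L := by
    have := Real.log_le_log (Real.exp_pos _) hqK
    rwa [Real.log_exp, ← hLdef] at this
  have hLnn : 0 ≤ L := by linarith
  -- degree budget s := ⌊q^(1+δ)⌋₊ and common size N := ⌈q^a⌉₊, a := n²/2 − n/8
  obtain ⟨a, hadef⟩ : ∃ a : ℝ, a = (n : ℝ) ^ 2 / 2 - 1 / 8 * n := ⟨_, rfl⟩
  have hqδnn : (0 : ℝ) ≤ (q : ℝ) ^ (1 + δ) := Real.rpow_nonneg hqpos.le _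
  have hqδ : (q : ℝ) ≤ (q : ℝ) ^ (1 + δ) := by
    have := Real.rpow_le_rpow_of_exponent_le hq1 (show (1 : ℝ) ≤ 1 + δ by linarith)
    rwa [Real.rpow_one] at this
  obtain ⟨s, hs2, hsle, hsdeg⟩ : ∃ s : ℕ, 2 ≤ s ∧ (s : ℝ) ≤ (q : ℝ) ^ (1 + δ) ∧
      ∀ d : ℕ, (d : ℝ) ≤ (q : ℝ) ^ (1 + δ) → d ≤ s :=
    ⟨⌊(q : ℝ) ^ (1 + δ)⌋₊, Nat.le_floor (by push_cast; linarith), Nat.floor_le hqδnn,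
      fun d hd => Nat.le_floor hd⟩
  have hs2r : (2 : ℝ) ≤ s := by exact_mod_cast hs2
  have hspos : (0 : ℝ) < s := by linarith
  have hqa : (0 : ℝ) < (q : ℝ) ^ a := Real.rpow_pos_of_pos hqpos a
  obtain ⟨N, hNge, hNle⟩ : ∃ N : ℕ, (q : ℝ) ^ a ≤ N ∧ ∀ m : ℕ, (q : ℝ) ^ a ≤ m → N ≤ m :=
    ⟨⌈(q : ℝ) ^ a⌉₊, Nat.le_ceil _, fun m hm => Nat.ceil_le.mpr hm⟩
  have hNpos : (0 : ℝ) < N := lt_of_lt_of_le hqa hNge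
  have hNNN : (0 : ℝ) < (N : ℝ) * N * N := by positivity
  -- tolerance η := 1/(2 (N³ + 1)); the designs at this tolerance, shrunk to N elements each
  obtain ⟨η, hηdef⟩ : ∃ η : ℝ, η = 1 / (2 * ((N : ℝ) * N * N + 1)) := ⟨_, rfl⟩
  have hηpos : 0 < η := by rw [hηdef]; positivity
  obtain ⟨X, Y, Z, -, hX, hY, hZ, hsep⟩ := hq η hηpos
  rw [← hadef] at hX hY hZ
  obtain ⟨X', hX'X, hX'card⟩ := Finset.exists_subset_card_eq (hNle _ hX)
  obtain ⟨Y', hY'Y, hY'card⟩ := Finset.exists_subset_card_eq (hNle _ hY)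
  obtain ⟨Z', hZ'Z, hZ'card⟩ := Finset.exists_subset_card_eq (hNle _ hZ)
  have hηN : η * ((X'.card : ℝ) * Y'.card * Z'.card) < 1 := by
    rw [hX'card, hY'card, hZ'card, hηdef, div_mul_eq_mul_div, one_mul, div_lt_one (by positivity)]
    linarith only [hNNN]
  have hcost := hL s hs2 X' Y' Z' η hηN (by
    intro x₀ hx₀ z₀ hz₀
    obtain ⟨p, hp, hsep'⟩ := hsep x₀ (hX'X hx₀) z₀ (hZ'Z hz₀)
    exact ⟨p, hsdeg _ hp, fun x hx y hy y' hy' z hz =>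
      hsep' x (hX'X hx) y (hY'Y hy) y' (hY'Y hy') z (hZ'Z hz)⟩)
  rw [hX'card, hY'card, hZ'card] at hcost
  -- take logarithms
  have hCh : (0 : ℝ) < ((2 * s + n ^ 2).choose (n ^ 2) : ℝ) := by
    exact_mod_cast Nat.choose_pos (Nat.le_add_left _ _)
  have hS1 : (0 : ℝ) < ((s : ℝ) + 1) ^ (n * (n - 1) / 2) := by positivity
  have hlog := Real.log_le_log hNNN hcost
  rw [Real.log_mul (mul_pos hCpos hS1).ne' hCh.ne', Real.log_mul hCpos.ne' hS1.ne',
    Real.log_pow] at hlog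
  have hN3 : Real.log ((N : ℝ) * N * N) = 3 * Real.log N := by
    rw [show (N : ℝ) * N * N = (N : ℝ) ^ 3 by ring, Real.log_pow]; push_cast; ring
  rw [hN3] at hlog
  -- the elementary estimates, M := (1+δ) log q
  obtain ⟨M, hMdef⟩ : ∃ M : ℝ, M = (1 + δ) * L := ⟨_, rfl⟩
  have hMnn : 0 ≤ M := by rw [hMdef]; exact mul_nonneg (by linarith) hLnn
  have hlogN : a * L ≤ Real.log N := by
    have := Real.log_le_log hqa hNge
    rwa [Real.log_rpow hqpos, ← hLdef] at this
  have hlogs : Real.log s ≤ M := by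
    have := Real.log_le_log hspos hsle
    rwa [Real.log_rpow hqpos, ← hLdef, ← hMdef] at this
  have hlog2 : Real.log 2 ≤ 1 := by
    have := Real.log_le_sub_one_of_pos (by norm_num : (0 : ℝ) < 2)
    linarith
  have hlogs1 : Real.log ((s : ℝ) + 1) ≤ 1 + M := by
    have h1 : (s : ℝ) + 1 ≤ 2 * s := by linarith
    have h2 := Real.log_le_log (by positivity) h1
    rw [Real.log_mul (by norm_num) hspos.ne'] at h2
    linarith only [h2, hlog2, hlogs]
  -- the exponent E := n(n-1)/2 (natural division) is at most (n² − n)/2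
  have hE : 2 * ((n * (n - 1) / 2 : ℕ) : ℝ) + n ≤ (n : ℝ) * n := by
    have h' : n * (n - 1) + n = n * n := by
      rw [Nat.mul_sub_one, Nat.sub_add_cancel (Nat.le_mul_self n)]
    have h1 : 2 * (n * (n - 1) / 2) + n ≤ n * n := by
      have := Nat.mul_div_le (n * (n - 1)) 2
      omega
    exact_mod_cast h1
  have hEnn : (0 : ℝ) ≤ ((n * (n - 1) / 2 : ℕ) : ℝ) := Nat.cast_nonneg _
  have hEle : ((n * (n - 1) / 2 : ℕ) : ℝ) ≤ ((n : ℝ) ^ 2 - n) / 2 := by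
    have e : (n : ℝ) ^ 2 = n * n := by ring
    rw [e]; linarith only [hE]
  have hE1 : ((n * (n - 1) / 2 : ℕ) : ℝ) * Real.log ((s : ℝ) + 1)
      ≤ ((n * (n - 1) / 2 : ℕ) : ℝ) * (1 + M) := mul_le_mul_of_nonneg_left hlogs1 hEnn
  have hE2 : ((n * (n - 1) / 2 : ℕ) : ℝ) * M ≤ ((n : ℝ) ^ 2 - n) / 2 * M :=
    mul_le_mul_of_nonneg_right hEle hMnn
  have hchoose : Real.log ((2 * s + n ^ 2).choose (n ^ 2) : ℝ) ≤
      (n : ℝ) ^ 2 * (M + 2 * Real.log n) := by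
    have h1 : ((2 * s + n ^ 2).choose (n ^ 2) : ℝ) ≤ (2 * (s : ℝ) + n ^ 2) ^ (n ^ 2) := by
      exact_mod_cast Nat.choose_le_pow (2 * s + n ^ 2) (n ^ 2)
    have h2 : Real.log ((2 * s + n ^ 2).choose (n ^ 2) : ℝ) ≤
        (n ^ 2 : ℕ) * Real.log (2 * (s : ℝ) + n ^ 2) := by
      rw [← Real.log_pow]; exact Real.log_le_log hCh h1
    have hn9 : (9 : ℝ) ≤ (n : ℝ) ^ 2 := by
      have h33 : (3 : ℝ) * 3 ≤ (n : ℝ) * n := mul_le_mul hn3r hn3r (by norm_num) hnpos.le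
      have e : (n : ℝ) ^ 2 = n * n := by ring
      rw [e]; linarith only [h33]
    have hA : (1 : ℝ) * 7 ≤ ((s : ℝ) - 1) * ((n : ℝ) ^ 2 - 2) :=
      mul_le_mul (by linarith only [hs2r]) (by linarith only [hn9]) (by norm_num)
        (by linarith only [hs2r])
    have h3 : 2 * (s : ℝ) + n ^ 2 ≤ s * n ^ 2 := by
      have e : ((s : ℝ) - 1) * ((n : ℝ) ^ 2 - 2) = s * n ^ 2 - 2 * s - n ^ 2 + 2 := by ring
      rw [e] at hA; linarith only [hA]
    have hn2pos : (0 : ℝ) < (n : ℝ) ^ 2 := by positivity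
    have h4 : Real.log (2 * (s : ℝ) + n ^ 2) ≤ Real.log s + 2 * Real.log n := by
      have := Real.log_le_log (by positivity) h3
      rw [Real.log_mul hspos.ne' hn2pos.ne', Real.log_pow] at this
      push_cast at this; linarith only [this]
    have h5 : Real.log (2 * (s : ℝ) + n ^ 2) ≤ M + 2 * Real.log n := by linarith only [h4, hlogs]
    have h6 : ((n ^ 2 : ℕ) : ℝ) = (n : ℝ) ^ 2 := by push_cast; ring
    rw [h6] at h2
    exact le_trans h2 (mul_le_mul_of_nonneg_left h5 hn2pos.le)
  -- main inequality: ((n+1)/32) log q ≤ log C + E + 2 n² log n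
  have hid : 3 * (a * L) - (((n : ℝ) ^ 2 - n) / 2 + n ^ 2) * M = ((n : ℝ) + 1) / 32 * L := by
    rw [hMdef, hadef, hδdef]; field_simp; ring
  have key : ((n : ℝ) + 1) / 32 * L ≤
      Real.log C + ((n * (n - 1) / 2 : ℕ) : ℝ) + 2 * (n : ℝ) ^ 2 * Real.log n := by
    rw [← hid]; linarith only [hlog, hlogN, hE1, hE2, hchoose]
  -- while log q ≥ K + 1, K = 8 (|log C| + n²/2 + 2 n² log n)
  have hK8 : (1 / 8 : ℝ) * L ≤ ((n : ℝ) + 1) / 32 * L :=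
    mul_le_mul_of_nonneg_right (by linarith) hLnn
  have habs : Real.log C ≤ |Real.log C| := le_abs_self _
  have hE3 : ((n * (n - 1) / 2 : ℕ) : ℝ) ≤ (n : ℝ) ^ 2 / 2 := by linarith only [hEle, hnpos]
  rw [hKdef] at hLK
  linarith only [key, hK8, habs, hE3, hLK]

end Summit.MatrixMultiplication.MatrixMultiplication.Theorems.BorderHalfDimensionDesigns
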